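import Mathlib.Combinatorics.SimpleGraph.Density
import Mathlib.Combinatorics.SimpleGraph.Finite
import Literature.Combinatorics.SimpleGraph.BrinkmannTuckerVanCleemput2021.Connectivity
import Literature.Combinatorics.SimpleGraph.BrinkmannTuckerVanCleemput2021.CutData16
import Literature.Combinatorics.SimpleGraph.BrinkmannTuckerVanCleemput2021.CutData20
import Literature.Combinatorics.SimpleGraph.BrinkmannTuckerVanCleemput2021.CutData67
import HarnessLib

/-!
# `G70` is cyclically 4-edge-connected

A snark, in Brinkmann–Tucker–Van Cleemput [BrinkmannTuckerVancleemput2021, §3.1] as usual, is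
a cyclically 4-edge-connected cubic graph of girth `≥ 5` and chromatic index 4; Kochol's
polyhedrally embedded counterexamples to Grünbaum's conjecture are snarks.  For a cubic graph,
cyclic 4-edge-connectivity — no set of at most three edges separates two cycles — is equivalent
to: every edge cut with at least two vertices on each side has at least four edges (a side `A`
of a cut with `≤ 3` edges and `|A| ≥ 2` spans `(3|A| - |δA|)/2 ≥ |A|` edges, so contains a
cycle; conversely a side containing a cycle has `≥ 3` vertices).  This module certifies the cut
form for `G70` (`…G70`):

`four_le_card_cut : ∀ A : Finset (Fin 70), 2 ≤ |A| → 2 ≤ |Aᶜ| → 4 ≤ |G70.interedges A Aᶜ|`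

(`interedges A Aᶜ` = the darts from `A` to its complement, one per cut edge), with the
corollaries `cut_le_three_trivial` (an edge cut with `≤ 3` edges isolates at most one vertex) and
`no_cyclic_cut_le_three` (deleting `≤ 3` edges never separates two cycles that avoid them — the
verbatim definition).

Method (data `…CutData16/20/67`, device `…Walks`): by the symmetry `|δA| = |δAᶜ|` assume
`0 ∈ A`.  If `|δA| ≤ 3` and `|A| ≥ 2` then some neighbour `y ∈ {16, 20, 67}` of `0` lies in `A`
(else the three edges at `0` are the whole cut and a walk `0 → a ∈ A \ {0}` from `…Connectivity`
would have to re-enter `A \ {0}` through the cut), and `Aᶜ` (`≥ 2` vertices, `≤ 3` cut edges,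
all degrees 3) contains an edge `{c, d}`; the kernel-checked table row for `({0, y}, {c, d})`
gives four pairwise edge-disjoint walks from `{0, y} ⊆ A` to `{c, d} ⊆ Aᶜ`, each crossing the
cut at a different edge: `|δA| ≥ 4`.  Standard axioms (`decide +kernel`).

Provenance: refutations bundle `papers/_cross/refutations` (H21 seat pub-refute-2, 2026-08-18);
written for the tree under the Lean-in-tree rule (human 2026-08-18).
-/

namespace Literature.Combinatorics.SimpleGraph.BrinkmannTuckerVanCleemput2021

open _root_.SimpleGraph Finset

/-- A listed walk runs from `0` or `y` to `c` or `d`. [folklore] -/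
def wOK (y c d : Fin 70) (l : List (Fin 70)) : Bool :=
  walkB 0 c l || walkB 0 d l || walkB y c l || walkB y d l

/-- Row check for the hub edge `{0, y}` against the edge `{c, d}`: the first four listed walks
run from `{0, y}` to `{c, d}` and are pairwise edge-disjoint. [folklore] -/
def cutOK (y c d : Fin 70) (ws : List (List ℕ)) : Bool :=
  wOK y c d (W (ws.getD 0 [])) && wOK y c d (W (ws.getD 1 [])) && wOK y c d (W (ws.getD 2 [])) &&
  wOK y c d (W (ws.getD 3 [])) &&
  edisj (W (ws.getD 0 [])) (W (ws.getD 1 [])) && edisj (W (ws.getD 0 [])) (W (ws.getD 2 [])) &&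
  edisj (W (ws.getD 0 [])) (W (ws.getD 3 [])) && edisj (W (ws.getD 1 [])) (W (ws.getD 2 [])) &&
  edisj (W (ws.getD 1 [])) (W (ws.getD 3 [])) && edisj (W (ws.getD 2 [])) (W (ws.getD 3 []))

/-- The walks filed in table `T` for the edge `{c, d}` (`c < d`; `[]` if absent). [folklore] -/
def cutRow (T : List (ℕ × ℕ × List (List ℕ))) (c d : ℕ) : List (List ℕ) :=
  match T.find? (fun r => r.1 == c && r.2.1 == d) with
  | some r => r.2.2
  | none => []

/-- Kernel fact: the table for the hub edge `{0, 16}` passes on every edge `{c, d}` of `G70`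
disjoint from it. [folklore] -/
theorem cut16_ok : ∀ c d : Fin 70, c < d → G70.Adj c d → c ≠ 0 → c ≠ 16 → d ≠ 0 → d ≠ 16 →
    cutOK 16 c d (cutRow cutData16 c d) = true := by
  decide +kernel

/-- Kernel fact: the table for the hub edge `{0, 20}` passes on every edge `{c, d}` of `G70`
disjoint from it. [folklore] -/
theorem cut20_ok : ∀ c d : Fin 70, c < d → G70.Adj c d → c ≠ 0 → c ≠ 20 → d ≠ 0 → d ≠ 20 →
    cutOK 20 c d (cutRow cutData20 c d) = true := by
  decide +kernel

/-- Kernel fact: the table for the hub edge `{0, 67}` passes on every edge `{c, d}` of `G70`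
disjoint from it. [folklore] -/
theorem cut67_ok : ∀ c d : Fin 70, c < d → G70.Adj c d → c ≠ 0 → c ≠ 67 → d ≠ 0 → d ≠ 67 →
    cutOK 67 c d (cutRow cutData67 c d) = true := by
  decide +kernel

/-- Kernel fact: the neighbours of `0` are `16`, `20`, `67`. [folklore] -/
theorem adj_zero_iff : ∀ y : Fin 70, G70.Adj 0 y ↔ y = 16 ∨ y = 20 ∨ y = 67 := by
  decide +kernel

/-- Membership in the cut `δA` (darts from `A` to its complement). [folklore] -/
theorem mem_cut {A : Finset (Fin 70)} {e : Fin 70 × Fin 70} :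
    e ∈ G70.interedges A Aᶜ ↔ e.1 ∈ A ∧ e.2 ∉ A ∧ G70.Adj e.1 e.2 := by
  rw [SimpleGraph.mem_interedges_iff, mem_compl]

/-- The cut has as many darts as the reverse cut. [folklore] -/
theorem card_cut_comm (A B : Finset (Fin 70)) :
    (G70.interedges A B).card = (G70.interedges B A).card :=
  have := G70.symm
  Rel.card_interedges_comm A B

/-- Four walks from `{0, y} ⊆ A` to `{c, d} ⊆ Aᶜ`, pairwise edge-disjoint, force four cut edges.
[folklore] -/
theorem four_le_of_cutOK {A : Finset (Fin 70)} {y c d : Fin 70} {ws : List (List ℕ)}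
    (hk : cutOK y c d ws = true) (h0 : (0 : Fin 70) ∈ A) (hy : y ∈ A) (hc : c ∉ A) (hd : d ∉ A) :
    4 ≤ (G70.interedges A Aᶜ).card := by
  simp only [cutOK, Bool.and_eq_true] at hk
  obtain ⟨⟨⟨⟨⟨⟨⟨⟨⟨w₁, w₂⟩, w₃⟩, w₄⟩, e₁₂⟩, e₁₃⟩, e₁₄⟩, e₂₃⟩, e₂₄⟩, e₃₄⟩ := hk
  have dart : ∀ {l : List (Fin 70)}, wOK y c d l = true →
      ∃ e ∈ dartsL l, e ∈ G70.interedges A Aᶜ := by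
    intro l hl
    have aux : ∀ {a b : Fin 70}, walkB a b l = true → a ∈ A → b ∉ A →
        ∃ e ∈ dartsL l, e ∈ G70.interedges A Aᶜ := fun h ha hb => by
      obtain ⟨e, he, h1, h2, h3⟩ := exists_dart_out h ha hb
      exact ⟨e, he, mem_cut.2 ⟨h1, h2, h3⟩⟩
    simp only [wOK, Bool.or_eq_true] at hl
    rcases hl with ((hl | hl) | hl) | hl
    exacts [aux hl h0 hc, aux hl h0 hd, aux hl hy hc, aux hl hy hd]
  obtain ⟨d₁, m₁, i₁⟩ := dart w₁
  obtain ⟨d₂, m₂, i₂⟩ := dart w₂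
  obtain ⟨d₃, m₃, i₃⟩ := dart w₃
  obtain ⟨d₄, m₄, i₄⟩ := dart w₄
  have n₁₂ := (edisj_sound e₁₂ m₁ m₂).1
  have n₁₃ := (edisj_sound e₁₃ m₁ m₃).1
  have n₁₄ := (edisj_sound e₁₄ m₁ m₄).1
  have n₂₃ := (edisj_sound e₂₃ m₂ m₃).1
  have n₂₄ := (edisj_sound e₂₄ m₂ m₄).1
  have n₃₄ := (edisj_sound e₃₄ m₃ m₄).1
  have hcard : ({d₁, d₂, d₃, d₄} : Finset (Fin 70 × Fin 70)).card = 4 := by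
    simp [card_insert_of_notMem, n₁₂, n₁₃, n₁₄, n₂₃, n₂₄, n₃₄]
  rw [← hcard]
  apply card_le_card
  intro e he
  simp only [mem_insert, mem_singleton] at he
  rcases he with rfl | rfl | rfl | rfl <;> assumption

/-- If a cut with at most three darts leaves at least two vertices outside `A`, two adjacent
vertices lie outside `A` (all degrees are `3`). [folklore] -/
theorem exists_adj_outside {A : Finset (Fin 70)} (h3 : (G70.interedges A Aᶜ).card ≤ 3)
    (hAc : 2 ≤ Aᶜ.card) : ∃ c d : Fin 70, c ∉ A ∧ d ∉ A ∧ G70.Adj c d := by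
  obtain ⟨c, hc⟩ : Aᶜ.Nonempty := card_pos.1 (by omega)
  have hcA : c ∉ A := mem_compl.1 hc
  by_cases hex : ∃ y, G70.Adj c y ∧ y ∉ A
  · obtain ⟨y, hy, hyA⟩ := hex
    exact ⟨c, y, hcA, hyA, hy⟩
  push Not at hex
  let T : Finset (Fin 70 × Fin 70) := (G70.neighborFinset c).map ⟨fun y => (y, c),
    fun y y' h => (Prod.ext_iff.1 h).1⟩
  have hT : T.card = 3 := by
    rw [card_map, card_neighborFinset_eq_degree, degree_eq_three]
  have hTsub : T ⊆ G70.interedges A Aᶜ := by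
    intro e he
    obtain ⟨y, hy, rfl⟩ := mem_map.1 he
    rw [mem_neighborFinset] at hy
    exact mem_cut.2 ⟨hex y hy, hcA, hy.symm⟩
  have hTeq : T = G70.interedges A Aᶜ := eq_of_subset_of_card_le hTsub (by omega)
  obtain ⟨c', hc', hne⟩ := exists_mem_ne (by omega : 1 < Aᶜ.card) c
  have hc'A : c' ∉ A := mem_compl.1 hc'
  by_cases h' : rot c' 0 ∈ A
  · have hm : (rot c' 0, c') ∈ T := hTeq ▸ mem_cut.2 ⟨h', hc'A, (adj_rot c' 0).symm⟩
    obtain ⟨y, -, hy⟩ := mem_map.1 hm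
    exact absurd (Prod.ext_iff.1 hy).2 hne.symm
  · exact ⟨c', rot c' 0, hc'A, h', adj_rot c' 0⟩

/-- If `0 ∈ A`, `|A| ≥ 2` and the cut has at most three darts, a neighbour of `0` lies in `A`
(else `A \ {0}` would be cut off from `0`, contradicting the walks of `…Connectivity`).
[folklore] -/
theorem exists_adj_zero_mem {A : Finset (Fin 70)} (h0 : (0 : Fin 70) ∈ A) (hA : 2 ≤ A.card)
    (h3 : (G70.interedges A Aᶜ).card ≤ 3) : ∃ y : Fin 70, G70.Adj 0 y ∧ y ∈ A := by
  by_contra hex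
  push Not at hex
  let T : Finset (Fin 70 × Fin 70) := (G70.neighborFinset 0).map ⟨fun y => ((0 : Fin 70), y),
    fun y y' h => (Prod.ext_iff.1 h).2⟩
  have hT : T.card = 3 := by
    rw [card_map, card_neighborFinset_eq_degree, degree_eq_three]
  have hTsub : T ⊆ G70.interedges A Aᶜ := by
    intro e he
    obtain ⟨y, hy, rfl⟩ := mem_map.1 he
    rw [mem_neighborFinset] at hy
    exact mem_cut.2 ⟨h0, hex y hy, hy⟩
  have hTeq : T = G70.interedges A Aᶜ := eq_of_subset_of_card_le hTsub (by omega)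
  obtain ⟨a, ha, hne⟩ := exists_mem_ne (by omega : 1 < A.card) (0 : Fin 70)
  obtain ⟨l₁, -, -, w₁, -⟩ := hub_walks (hub0_ok a hne)
  obtain ⟨e, -, h1, h2, h3'⟩ :=
    exists_dart_in (S := A.erase 0) w₁ (by simp) (mem_erase.2 ⟨hne, ha⟩)
  rw [mem_erase] at h1 h2
  by_cases he1 : e.1 = 0
  · exact hex e.2 (he1 ▸ h3') h2.2
  · have he1A : e.1 ∉ A := fun h => h1 ⟨he1, h⟩
    have hm : (e.2, e.1) ∈ T := hTeq ▸ mem_cut.2 ⟨h2.2, he1A, h3'.symm⟩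
    obtain ⟨y, -, hy⟩ := mem_map.1 hm
    exact h2.1 (Prod.ext_iff.1 hy).1.symm

/-- The kernel tables applied: with `0, y ∈ A` for a neighbour `y` of `0` and an edge `{c, d}`
outside `A`, the cut has at least four darts. [folklore] -/
theorem four_le_of_side {A : Finset (Fin 70)} (h0 : (0 : Fin 70) ∈ A) {y : Fin 70}
    (hy0 : G70.Adj 0 y) (hy : y ∈ A) {c d : Fin 70} (hcd : G70.Adj c d) (hc : c ∉ A)
    (hd : d ∉ A) : 4 ≤ (G70.interedges A Aᶜ).card := by
  have hc0 : c ≠ 0 := fun h => hc (h ▸ h0)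
  have hd0 : d ≠ 0 := fun h => hd (h ▸ h0)
  have hcy : c ≠ y := fun h => hc (h ▸ hy)
  have hdy : d ≠ y := fun h => hd (h ▸ hy)
  have key : ∀ (T : List (ℕ × ℕ × List (List ℕ))),
      (∀ c d : Fin 70, c < d → G70.Adj c d → c ≠ 0 → c ≠ y → d ≠ 0 → d ≠ y →
        cutOK y c d (cutRow T c d) = true) → 4 ≤ (G70.interedges A Aᶜ).card := by
    intro T hT
    rcases lt_or_gt_of_ne hcd.ne with h | h
    · exact four_le_of_cutOK (hT c d h hcd hc0 hcy hd0 hdy) h0 hy hc hd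
    · exact four_le_of_cutOK (hT d c h hcd.symm hd0 hdy hc0 hcy) h0 hy hd hc
  rcases (adj_zero_iff y).1 hy0 with rfl | rfl | rfl
  exacts [key _ cut16_ok, key _ cut20_ok, key _ cut67_ok]

/-- The cut form of cyclic 4-edge-connectivity, for sides containing `0`. [folklore] -/
theorem four_le_card_cut_of_zero_mem {A : Finset (Fin 70)} (h0 : (0 : Fin 70) ∈ A)
    (hA : 2 ≤ A.card) (hAc : 2 ≤ Aᶜ.card) : 4 ≤ (G70.interedges A Aᶜ).card := by
  by_contra hlt
  have h3 : (G70.interedges A Aᶜ).card ≤ 3 := by omega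
  obtain ⟨y, hy0, hy⟩ := exists_adj_zero_mem h0 hA h3
  obtain ⟨c, d, hc, hd, hcd⟩ := exists_adj_outside h3 hAc
  exact hlt (four_le_of_side h0 hy0 hy hcd hc hd)

/-- **`G70` is cyclically 4-edge-connected (cut form)**: every edge cut with at least two
vertices on each side has at least four edges. [cite: BrinkmannTuckerVancleemput2021, §3.1] -/
theorem four_le_card_cut (A : Finset (Fin 70)) (hA : 2 ≤ A.card) (hAc : 2 ≤ Aᶜ.card) :
    4 ≤ (G70.interedges A Aᶜ).card := by
  by_cases h0 : (0 : Fin 70) ∈ A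
  · exact four_le_card_cut_of_zero_mem h0 hA hAc
  · have h := four_le_card_cut_of_zero_mem (A := Aᶜ) (mem_compl.2 h0) hAc (by simpa using hA)
    rwa [compl_compl, card_cut_comm] at h

/-- Every edge cut of `G70` with at most three edges is trivial (isolates at most one vertex on
one side). [folklore] -/
theorem cut_le_three_trivial (A : Finset (Fin 70)) (h : (G70.interedges A Aᶜ).card ≤ 3) :
    A.card ≤ 1 ∨ Aᶜ.card ≤ 1 := by
  by_contra hh
  rw [not_or, not_le, not_le] at hh
  have := four_le_card_cut A hh.1 hh.2
  omega

/-- **`G70` is cyclically 4-edge-connected (verbatim form)**: deleting a set `s` of at most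
three edges never separates two cycles avoiding `s` — their base points remain joined in
`G70 - s`. [cite: BrinkmannTuckerVancleemput2021, §3.1] -/
theorem no_cyclic_cut_le_three (s : Finset (Sym2 (Fin 70))) (hs : s.card ≤ 3) {a b : Fin 70}
    (ca : G70.Walk a a) (cb : G70.Walk b b) (hca : ca.IsCycle) (hcb : cb.IsCycle)
    (hsa : ∀ e ∈ ca.edges, e ∉ s) (hsb : ∀ e ∈ cb.edges, e ∉ s) :
    (G70.deleteEdges (s : Set (Sym2 (Fin 70)))).Reachable a b := by
  classical
  by_contra hab
  set H := G70.deleteEdges (s : Set (Sym2 (Fin 70))) with hH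
  let A : Finset (Fin 70) := univ.filter fun w => H.Reachable a w
  have hmemA : ∀ w, w ∈ A ↔ H.Reachable a w := fun w => by simp [A]
  -- a cycle base point and its first neighbour are on the same side
  have step : ∀ {x : Fin 70} (c : G70.Walk x x), c.IsCycle → (∀ e ∈ c.edges, e ∉ s) →
      ∃ x', x' ≠ x ∧ H.Adj x x' := by
    intro x c hc hcs
    cases c with
    | nil => exact absurd hc Walk.not_isCycle_nil
    | cons hxy q =>
      rename_i y
      refine ⟨y, hxy.ne.symm, ?_⟩
      rw [deleteEdges_adj]
      exact ⟨hxy, by exact_mod_cast hcs _ (by simp [Walk.edges_cons])⟩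
  obtain ⟨a', ha', haa'⟩ := step ca hca hsa
  obtain ⟨b', hb', hbb'⟩ := step cb hcb hsb
  have haA : a ∈ A := (hmemA a).2 Reachable.rfl
  have ha'A : a' ∈ A := (hmemA a').2 haa'.reachable
  have hbA : b ∉ A := fun h => hab ((hmemA b).1 h)
  have hb'A : b' ∉ A := fun h => hab (((hmemA b').1 h).trans hbb'.reachable.symm)
  have hA : 2 ≤ A.card := by
    have : ({a, a'} : Finset (Fin 70)) ⊆ A := by simp [insert_subset_iff, haA, ha'A]
    exact le_trans (by rw [card_pair ha'.symm]) (card_le_card this)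
  have hAc : 2 ≤ Aᶜ.card := by
    have : ({b, b'} : Finset (Fin 70)) ⊆ Aᶜ := by simp [insert_subset_iff, hbA, hb'A]
    exact le_trans (by rw [card_pair hb'.symm]) (card_le_card this)
  -- every cut dart is an edge of `s`
  have himg : ∀ e ∈ G70.interedges A Aᶜ, s(e.1, e.2) ∈ s := by
    intro e he
    obtain ⟨h1, h2, h3⟩ := mem_cut.1 he
    by_contra hns
    have hadj : H.Adj e.1 e.2 := by
      rw [hH, deleteEdges_adj]
      exact ⟨h3, by exact_mod_cast hns⟩
    exact h2 ((hmemA _).2 (((hmemA _).1 h1).trans hadj.reachable))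
  have hinj : Set.InjOn (fun e : Fin 70 × Fin 70 => s(e.1, e.2)) ↑(G70.interedges A Aᶜ) := by
    intro e he e' he' hee'
    obtain ⟨h1, h2, -⟩ := mem_cut.1 (mem_coe.1 he)
    obtain ⟨h1', h2', -⟩ := mem_cut.1 (mem_coe.1 he')
    rcases Sym2.eq_iff.1 hee' with ⟨h3, h4⟩ | ⟨h3, h4⟩
    · exact Prod.ext h3 h4
    · exact absurd (h3 ▸ h1) h2'
  have hle : (G70.interedges A Aᶜ).card ≤ s.card := by
    rw [← card_image_of_injOn hinj]
    exact card_le_card fun f hf => by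
      obtain ⟨e, he, rfl⟩ := mem_image.1 hf
      exact himg e he
  have h4 := four_le_card_cut A hA hAc
  omega

end Literature.Combinatorics.SimpleGraph.BrinkmannTuckerVanCleemput2021
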